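import Literature.NumberTheory.EllipticCurves.TwoIsogenyCasselsParity
import Literature.NumberTheory.EllipticCurves.BSDQuadraticDescentCasselsPairingProofs
import Literature.NumberTheory.EllipticCurves.CasselsTateIsogenyAdjoint
import Literature.NumberTheory.EllipticCurves.BSDpVariableChangeProofs
import Literature.NumberTheory.EllipticCurves.TianYuanZhang2017.GenusDescentEnSide
import HarnessLib

/-!
# Crux `PrintCf2.RamifiedOffTYZOfFacts` (stmt-BirchSwinnertonDyer-20509), line `offtyz-v7`, LEAD cycle 21 (cruxlead-20509 g20), part 1/3:
# CASSELS' RELATION FOR THE DESCENT VIA `2`-ISOGENY IN SELMER FORM, and its `2`-primary reading on `E_n` and the partner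
# `A_n : Y² = X³ + 4n²X`

THEOREMS ONLY (no `def`, no named fact introduced, no `sorry`), `--supports stmt-BirchSwinnertonDyer-20509` (C⁺ = item 23431
`RamifiedJumpOneLevelTwoOfFacts`, stub 7 of the registered skeleton v9).  HONEST FRAMING: pure descent bookkeeping on tree theorems
(Silverman X.4.2(a) counted for both explicit `2`-isogenies, `TwoIsogenySelmerGroupSha`; `im Ξ = ker φ_*`, `TwoIsogenyTorsorImage`;
`ker Ш(φ̂) = ker Ш(φ_{E})`, `TwoIsogenyDualKernel`; Milne's duality step `#coker Ш(φ) = #ker Ш(φ̂)`, `BSDQuadraticDescentCasselsPairingProofs`)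
GRANTED the Cassels–Tate pairing in functorial form over `ℚ` — the tree's named fact
`Literature.NumberTheory.EllipticCurves.exists_casselsTate_pairing_adjoint ℚ` (Milne, *ADT*, I, Prop. 6.9, Rem. 6.10(a), Thm. 6.13(a);
Cassels 1962/1965), taken as a HYPOTHESIS `hCT` (conditional result; nothing about it is discharged here).  Nothing about BSD is
asserted; C⁺ and the crux stay OPEN; BSD is not proved by any of this.

* §1 `card_sha_mul_two_pow_eq_of_casselsTate` — for `E = E_{a,b} : y² = x³ + ax² + bx` over `ℚ` (`a, b ∈ ℤ`, `b(a² − 4b) ≠ 0`) with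
  `Ш(E/ℚ)` finite and `V₀ ≅ E'` the half-model (`V₀' = E` literally):
  **`#Ш(E) · 2^{dim S(a,b)} · 2^{rank E(ℚ)+2} = #Ш(V₀) · 2^{dim S'(a,b)} · #α(E(ℚ))²`** (`S`, `S'` the two explicit isogeny Selmer
  groups of the tree, `α` the `x`-coordinate class on `E(ℚ)`, Silverman–Tate §3.5).
* §2 `card_shaTwo_mul_two_pow_eq_of_casselsTate` — the same with `Ш` replaced by `Ш[2^∞]` (`#Ш[2^∞] = 2^{ord₂ #Ш}`).
* §3 `card_shaTwo_congruent_mul_eq_of_casselsTate` — the congruent number curve `E_n = congruentNumberCurve n = E_{0,−n²}` and its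
  partner `A_n = E_n.twoIsogenyCodomain : Y² = X³ + 4n²X` (`= ⟨2⁻¹,0,0,0⟩ • V₀`, `Ш[2^∞]` is a model invariant):
  **`#Ш(E_n)[2^∞] · 2^{dim S(0,−n²)} · 2^{rank+2} = #Ш(A_n)[2^∞] · 2^{dim S'(0,−n²)} · #α(E_n(ℚ))²`**.
  Parts 2/3 (`…PartnerShaRho`, `…PartnerShaRigidity`) read `#α(E_n(ℚ)) = 4·2^{ρ(n)}` (Tian–Yuan–Zhang's `ρ`) and derive the
  `ρ`-rigidity of the jump-one class through `Ш(A_n)`.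

What this buys the line (LEAD census, crux 20509): the relation `#Ш(E_n)[2^∞] = 4^{ρ(n)}·#Ш(A_n)[2^∞]` that cruxlead g15 used
NUMERICALLY (1568/1568) to read `ρ` off `dim Sel₂(A_n)` on the G-locus is a THEOREM modulo the Cassels–Tate fact, on the two-prime
shape `dim S = 3`, `dim S' = 2` (part 3).  Beyond-print theorem: NO (Cassels 1965 bookkeeping).  BSD is not proved by any of this.

References: [cite: MilneADT2006, Ch. I, Prop. 6.9, Rem. 6.10(a), Thm. 6.13(a), proof of Thm. 7.3 (p. 98)]; [cite: Cassels1965ArithmeticVIII];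
[cite: SilvermanAEC2009, Thm. X.4.2(a), Prop. X.4.9, III.6.1]; [cite: SilvermanTate2015, §3.5–§3.6]; [cite: TianYuanZhang2017, §1 (ρ(n), A_n)];
tree: `TwoIsogenySelmerGroupSha`, `TwoIsogenyCasselsParity`, `BSDQuadraticDescentCasselsPairingProofs`, `CasselsTateIsogenyAdjoint`.
-/

noncomputable section

open scoped Classical

open WeierstrassCurve Literature.NumberTheory.EllipticCurves

namespace Summit.BirchSwinnertonDyer.PrintCf2.PartnerSha

/-! ## §1 Cassels' relation for the explicit `2`-isogeny, in Selmer form (any `E_{a,b}/ℚ`) -/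

/-- Transport of `#Ш` along an equality of curves. [folklore] -/
theorem natCard_sha_congr {X Y : WeierstrassCurve ℚ} (h : X = Y) : Nat.card X.sha = Nat.card Y.sha := by
  subst h; rfl

/-- Transport of `Finite Ш` along an equality of curves. [folklore] -/
theorem finite_sha_congr {X Y : WeierstrassCurve ℚ} (h : X = Y) (hY : Finite Y.sha) : Finite X.sha := by
  subst h; exact hY

/-- **Cassels' relation for the descent via `2`-isogeny, in Selmer form.** For `E = E_{a,b} : y² = x³ + ax² + bx`
over `ℚ` (`b(a² − 4b) ≠ 0`) with `Ш(E/ℚ)` finite, `V₀` the half-model of `E' = E_{−2a, a²−4b}` (`V₀' = E` literally),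
granted the Cassels–Tate pairing in functorial (adjoint) form over `ℚ` (Milne, *ADT*, I.6.9, 6.10(a), 6.13(a)):

  `#Ш(E) · 2^{dim S(a,b)} · 2^{rank E(ℚ) + 2} = #Ш(V₀) · 2^{dim S'(a,b)} · #α(E(ℚ))²`.

Proof: Milne's `#coker Ш(φ₀) = #ker Ш(φ̂₀)` step (`Isogeny.card_sha_mul_card_ker_eq_of_pairing`) for `φ₀ : V₀ → E`
gives `#Ш(V₀) · #Ш(E)[φ_E] = #Ш(E) · #Ш(V₀)[φ₀]` (`ker Ш(φ̂₀) = ker Ш(φ_E)`, `ker_shaMap_eq_of_comp_twoIsogeny`); the two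
counts `2^{dim S} = #α(E(ℚ))·#Ш(V₀)[φ₀]`, `2^{dim S'} = #ᾱ(E'(ℚ))·#Ш(E)[φ_E]` (AEC X.4.2(a)) and `#α·#ᾱ = 2^{rank+2}`
(Silverman–Tate §3.6) eliminate the kernels. [cite: MilneADT2006, Ch. I, proof of Thm. 7.3 (p. 98), Rem. 6.10(a), Thm. 6.13(a)]
[cite: SilvermanAEC2009, Thm. X.4.2(a), Prop. X.4.9] [cite: SilvermanTate2015, §3.6] -/
theorem card_sha_mul_two_pow_eq_of_casselsTate {a b : ℤ} (hab : b * (a ^ 2 - 4 * b) ≠ 0)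
    (hCT : exists_casselsTate_pairing_adjoint ℚ)
    (hfin : Finite (⟨0, (a : ℚ), 0, (b : ℚ), 0⟩ : WeierstrassCurve ℚ).sha) :
    Nat.card (⟨0, (a : ℚ), 0, (b : ℚ), 0⟩ : WeierstrassCurve ℚ).sha * 2 ^ twoIsogenySelmerRank a b *
        2 ^ ((haveI := isElliptic_mk_of_ne_zero (F := ℚ) hab;
          (⟨0, (a : ℚ), 0, (b : ℚ), 0⟩ : WeierstrassCurve ℚ).mordellWeilRank) + 2) =
      Nat.card (⟨0, -(a : ℚ) / 2, 0, ((a : ℚ) ^ 2 - 4 * b) / 16, 0⟩ : WeierstrassCurve ℚ).sha *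
        2 ^ twoIsogenySelmerRank' a b *
        Nat.card (Set.range (⟨0, (a : ℚ), 0, (b : ℚ), 0⟩ : WeierstrassCurve ℚ).xSqClass) ^ 2 := by
  haveI hV₀ := isElliptic_halfModel hab
  haveI hE := isElliptic_mk_of_ne_zero (F := ℚ) hab
  set V₀ : WeierstrassCurve ℚ := ⟨0, -(a : ℚ) / 2, 0, ((a : ℚ) ^ 2 - 4 * b) / 16, 0⟩ with hV₀def
  have hE' : V₀.twoIsogenyCodomain = ⟨0, (a : ℚ), 0, (b : ℚ), 0⟩ := twoIsogenyCodomain_halfModel a b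
  -- the dual of `φ₀ = V₀.twoIsogeny`
  obtain ⟨ψ, hψ⟩ := Isogeny.exists_dual_of_isElliptic V₀.twoIsogeny
  have hψ2 : ∀ P : V₀.geomPoints, ψ.toAddMonoidHom (V₀.twoIsogenyGeomHom P) = (2 : ℤ) • P := by
    intro P
    have h := hψ P
    rw [degree_twoIsogeny] at h
    exact h
  -- finiteness of the two Tate–Shafarevich groups
  haveI hfin' : Finite V₀.twoIsogenyCodomain.sha := finite_sha_congr hE' hfin
  haveI hfin₀ : Finite V₀.sha := by
    have h : V₀.twoIsogenyCodomain.ShaFinite := hfin'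
    exact (V₀.twoIsogeny.shaFinite_iff_shaFinite).mpr h
  -- the Cassels–Tate pairings for the dual pair `(φ₀, ψ)`
  obtain ⟨B, B', hBalt, hBker, _, hB'ker, hadj⟩ := hCT V₀ V₀.twoIsogenyCodomain V₀.twoIsogeny ψ hψ
  have hB' : ∀ x, (∀ y, B' x y = 0) → x = 0 := fun x hx ↦ by
    simpa [divisibleElements_eq_bot_of_finite] using (hB'ker x).mp hx
  have hB : ∀ y, (∀ x, B x y = 0) → y = 0 := fun y hy ↦ by
    have hy' : ∀ x, B y x = 0 := fun x ↦ by rw [pairing_swap_eq_neg B hBalt x y, hy x, _root_.neg_zero]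
    simpa [divisibleElements_eq_bot_of_finite] using (hBker y).mp hy'
  -- Milne's step: `#Ш(V₀) · #ker Ш(ψ) = #Ш(V₀') · #ker Ш(φ₀)`
  have hC := Isogeny.card_sha_mul_card_ker_eq_of_pairing V₀.twoIsogeny ψ B B' hB hB' hadj
  -- `#ker Ш(φ₀) = #(Ш(V₀) ∩ im Ξ_{V₀})`
  have hkerφ : Nat.card (shaMap V₀.twoIsogeny.toAddMonoidHom V₀.twoIsogeny.equivariant
      V₀.twoIsogeny.hasLocalPointsMaps_toAddMonoidHom).ker =
      Nat.card ↥(V₀.sha ⊓ AddMonoidHom.range (G := Additive (Affine.SqUnits ℚ)) V₀.twoIsogenyTorsorHom) :=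
    (natCard_sha_inf_range_twoIsogenyTorsorHom_eq V₀ V₀.twoIsogeny.hasLocalPointsMaps_toAddMonoidHom).symm
  -- `#ker Ш(ψ) = #ker Ш(φ_{V₀'}) = #(Ш(V₀') ∩ im Ξ_{V₀'})`
  have hkerψ : Nat.card (shaMap ψ.toAddMonoidHom ψ.equivariant ψ.hasLocalPointsMaps_toAddMonoidHom).ker =
      Nat.card ↥(V₀.twoIsogenyCodomain.sha ⊓
        AddMonoidHom.range (G := Additive (Affine.SqUnits ℚ)) V₀.twoIsogenyCodomain.twoIsogenyTorsorHom) := by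
    rw [natCard_sha_inf_range_twoIsogenyTorsorHom_eq V₀.twoIsogenyCodomain
      V₀.twoIsogenyCodomain.twoIsogeny.hasLocalPointsMaps_toAddMonoidHom,
      ← ker_shaMap_eq_of_comp_twoIsogeny ψ.toAddMonoidHom ψ.equivariant (fun P ↦ ?_)
        ψ.hasLocalPointsMaps_toAddMonoidHom V₀.twoIsogenyCodomain.twoIsogeny.hasLocalPointsMaps_toAddMonoidHom]
    rw [hψ2, ← natCast_zsmul]
    rfl
  rw [hkerφ, hkerψ, natCard_sha_inf_range_twoIsogenyTorsorHom_congr hE', natCard_sha_congr hE'] at hC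
  -- the two Selmer counts and `#α · #ᾱ = 2^{rank + 2}`
  have hS := two_pow_twoIsogenySelmerRank_eq_natCard_mul_halfModel (a := a) (b := b) hab
  have hS' := two_pow_twoIsogenySelmerRank'_eq_natCard_mul (a := a) (b := b) hab
  have hαα := (⟨0, (a : ℚ), 0, (b : ℚ), 0⟩ : WeierstrassCurve ℚ).natCard_range_xSqClass_mul
  rw [twoIsogenyCodomain_mk_intCast] at hαα
  -- bookkeeping: with x = #Ш(V₀)[Ξ], y = #Ш(E)[Ξ], α, ᾱ:  #Ш(V₀)·y = #Ш(E)·x, 2^S = α x, 2^S' = ᾱ y, αᾱ = 2^{r+2}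
  set x := Nat.card ↥(V₀.sha ⊓ AddMonoidHom.range (G := Additive (Affine.SqUnits ℚ)) V₀.twoIsogenyTorsorHom)
  set y := Nat.card ↥((⟨0, (a : ℚ), 0, (b : ℚ), 0⟩ : WeierstrassCurve ℚ).sha ⊓
    AddMonoidHom.range (G := Additive (Affine.SqUnits ℚ))
      (⟨0, (a : ℚ), 0, (b : ℚ), 0⟩ : WeierstrassCurve ℚ).twoIsogenyTorsorHom)
  set α := Nat.card (Set.range (⟨0, (a : ℚ), 0, (b : ℚ), 0⟩ : WeierstrassCurve ℚ).xSqClass)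
  set ᾱ := Nat.card (Set.range
    (⟨0, ((-2 * a : ℤ) : ℚ), 0, ((a ^ 2 - 4 * b : ℤ) : ℚ), 0⟩ : WeierstrassCurve ℚ).xSqClass)
  set shE := Nat.card (⟨0, (a : ℚ), 0, (b : ℚ), 0⟩ : WeierstrassCurve ℚ).sha
  set shV := Nat.card V₀.sha
  rw [hS, hS', ← hαα]
  calc shE * (α * x) * (α * ᾱ) = α * α * ᾱ * (shE * x) := by ring
    _ = α * α * ᾱ * (shV * y) := by rw [hC]
    _ = shV * (ᾱ * y) * α ^ 2 := by ring


/-! ## §2 The `2`-primary form -/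

/-- A natural number dividing a power of `2` is `2` to its `2`-adic valuation. [folklore] -/
theorem eq_two_pow_padicValNat_of_dvd {m k : ℕ} (h : m ∣ 2 ^ k) : m = 2 ^ padicValNat 2 m := by
  obtain ⟨j, -, rfl⟩ := (Nat.dvd_prime_pow Nat.prime_two).mp h
  rw [padicValNat.prime_pow]

/-- `2`-adic bookkeeping: from `A · 2^s · 2^t = B · 2^{s'} · C²` with `A, B ≠ 0` and `C ∣ 2^t`, the same identity holds
with `A`, `B` replaced by `2^{ord₂ A}`, `2^{ord₂ B}`. [folklore] -/
theorem two_pow_padicValNat_mul_eq {A B C s s' t : ℕ} (hA : A ≠ 0) (hB : B ≠ 0) (hC : C ∣ 2 ^ t)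
    (h : A * 2 ^ s * 2 ^ t = B * 2 ^ s' * C ^ 2) :
    2 ^ padicValNat 2 A * 2 ^ s * 2 ^ t = 2 ^ padicValNat 2 B * 2 ^ s' * C ^ 2 := by
  haveI : Fact (Nat.Prime 2) := ⟨Nat.prime_two⟩
  have hC0 : C ≠ 0 := by
    rintro rfl
    exact absurd (zero_dvd_iff.mp hC) (pow_ne_zero _ two_ne_zero)
  have hv := congrArg (padicValNat 2) h
  rw [padicValNat.mul (mul_ne_zero hA (pow_ne_zero _ two_ne_zero)) (pow_ne_zero _ two_ne_zero),
    padicValNat.mul hA (pow_ne_zero _ two_ne_zero),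
    padicValNat.mul (mul_ne_zero hB (pow_ne_zero _ two_ne_zero)) (pow_ne_zero _ hC0),
    padicValNat.mul hB (pow_ne_zero _ two_ne_zero), padicValNat.prime_pow, padicValNat.prime_pow,
    padicValNat.prime_pow, padicValNat.pow C 2] at hv
  have hCeq := eq_two_pow_padicValNat_of_dvd hC
  set k := padicValNat 2 C with hk
  rw [hCeq, ← pow_mul, ← pow_add, ← pow_add, ← pow_add, ← pow_add]
  congr 1
  omega

/-- **Cassels' relation, `2`-primary form.** Under the hypotheses of `card_sha_mul_two_pow_eq_of_casselsTate`:

  `#Ш(E)[2^∞] · 2^{dim S(a,b)} · 2^{rank E(ℚ) + 2} = #Ш(V₀)[2^∞] · 2^{dim S'(a,b)} · #α(E(ℚ))²`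

(`#Ш[2^∞] = 2^{ord₂ #Ш}` for a finite `Ш`, `card_addPrimaryComponent_eq_pow`; `#α(E(ℚ)) ∣ 2^{rank+2}`).
[cite: MilneADT2006, Ch. I, proof of Thm. 7.3 (p. 98)] [cite: SilvermanAEC2009, Thm. X.4.2(a), Prop. X.4.9] -/
theorem card_shaTwo_mul_two_pow_eq_of_casselsTate {a b : ℤ} (hab : b * (a ^ 2 - 4 * b) ≠ 0)
    (hCT : exists_casselsTate_pairing_adjoint ℚ)
    (hfin : Finite (⟨0, (a : ℚ), 0, (b : ℚ), 0⟩ : WeierstrassCurve ℚ).sha) :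
    Nat.card (AddCommGroup.primaryComponent (⟨0, (a : ℚ), 0, (b : ℚ), 0⟩ : WeierstrassCurve ℚ).sha 2) *
        2 ^ twoIsogenySelmerRank a b *
        2 ^ ((haveI := isElliptic_mk_of_ne_zero (F := ℚ) hab;
          (⟨0, (a : ℚ), 0, (b : ℚ), 0⟩ : WeierstrassCurve ℚ).mordellWeilRank) + 2) =
      Nat.card (AddCommGroup.primaryComponent
          (⟨0, -(a : ℚ) / 2, 0, ((a : ℚ) ^ 2 - 4 * b) / 16, 0⟩ : WeierstrassCurve ℚ).sha 2) *
        2 ^ twoIsogenySelmerRank' a b *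
        Nat.card (Set.range (⟨0, (a : ℚ), 0, (b : ℚ), 0⟩ : WeierstrassCurve ℚ).xSqClass) ^ 2 := by
  haveI hV₀ := isElliptic_halfModel hab
  haveI hE := isElliptic_mk_of_ne_zero (F := ℚ) hab
  haveI : Finite (⟨0, (a : ℚ), 0, (b : ℚ), 0⟩ : WeierstrassCurve ℚ).sha := hfin
  have hE' : (⟨0, -(a : ℚ) / 2, 0, ((a : ℚ) ^ 2 - 4 * b) / 16, 0⟩ : WeierstrassCurve ℚ).twoIsogenyCodomain =
      ⟨0, (a : ℚ), 0, (b : ℚ), 0⟩ := twoIsogenyCodomain_halfModel a b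
  haveI hfin₀ : Finite (⟨0, -(a : ℚ) / 2, 0, ((a : ℚ) ^ 2 - 4 * b) / 16, 0⟩ : WeierstrassCurve ℚ).sha := by
    have h : (⟨0, -(a : ℚ) / 2, 0, ((a : ℚ) ^ 2 - 4 * b) / 16, 0⟩ :
        WeierstrassCurve ℚ).twoIsogenyCodomain.ShaFinite := finite_sha_congr hE' hfin
    exact ((⟨0, -(a : ℚ) / 2, 0, ((a : ℚ) ^ 2 - 4 * b) / 16, 0⟩ :
      WeierstrassCurve ℚ).twoIsogeny.shaFinite_iff_shaFinite).mpr h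
  have h := card_sha_mul_two_pow_eq_of_casselsTate hab hCT hfin
  have hαα := (⟨0, (a : ℚ), 0, (b : ℚ), 0⟩ : WeierstrassCurve ℚ).natCard_range_xSqClass_mul
  have hdvd : Nat.card (Set.range (⟨0, (a : ℚ), 0, (b : ℚ), 0⟩ : WeierstrassCurve ℚ).xSqClass) ∣
      2 ^ ((⟨0, (a : ℚ), 0, (b : ℚ), 0⟩ : WeierstrassCurve ℚ).mordellWeilRank + 2) :=
    Dvd.intro _ hαα
  have key := two_pow_padicValNat_mul_eq (Nat.card_pos (α := (⟨0, (a : ℚ), 0, (b : ℚ), 0⟩ :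
      WeierstrassCurve ℚ).sha)).ne' (Nat.card_pos (α := (⟨0, -(a : ℚ) / 2, 0, ((a : ℚ) ^ 2 - 4 * b) / 16, 0⟩ :
      WeierstrassCurve ℚ).sha)).ne' hdvd h
  rwa [← Nat.factorization_def _ Nat.prime_two, ← Nat.factorization_def _ Nat.prime_two,
    ← card_addPrimaryComponent_eq_pow, ← card_addPrimaryComponent_eq_pow] at key

/-! ## §3 The congruent number curve `E_n : y² = x³ − n²x` and its partner `A_n : Y² = X³ + 4n²X` -/

/-- `E_n` is the two-torsion normal form `E_{0, −n²}` with INTEGER parameters (cast bookkeeping). [folklore] -/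
theorem congruentNumberCurve_eq_mk (n : ℕ) :
    congruentNumberCurve n = (⟨0, ((0 : ℤ) : ℚ), 0, ((-((n : ℤ) ^ 2) : ℤ) : ℚ), 0⟩ : WeierstrassCurve ℚ) := by
  simp [congruentNumberCurve]

/-- `b(a² − 4b) = −n²·4n² ≠ 0` for `(a, b) = (0, −n²)`, `n ≠ 0`. [folklore] -/
theorem hab_congruent {n : ℕ} (hn : n ≠ 0) :
    (-((n : ℤ) ^ 2)) * ((0 : ℤ) ^ 2 - 4 * (-((n : ℤ) ^ 2))) ≠ 0 := by
  have hn' : (n : ℤ) ≠ 0 := by exact_mod_cast hn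
  have : (-((n : ℤ) ^ 2)) * ((0 : ℤ) ^ 2 - 4 * (-((n : ℤ) ^ 2))) = -(4 * (n : ℤ) ^ 4) := by ring
  rw [this]
  exact neg_ne_zero.mpr (by positivity)

/-- The partner `A_n = E_n' : Y² = X³ + 4n²X` (`(congruentNumberCurve n).twoIsogenyCodomain`) is the half-model
`V₀ : y² = x³ + (n²/4)x` rescaled by `u = 1/2`: `⟨(2)⁻¹, 0, 0, 0⟩ • V₀ = A_n`. [folklore] -/
theorem smul_halfModel_eq_twoIsogenyCodomain (n : ℕ) :
    (⟨(Units.mk0 (2 : ℚ) two_ne_zero)⁻¹, 0, 0, 0⟩ : VariableChange ℚ) •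
        (⟨0, -(((0 : ℤ) : ℚ)) / 2, 0, ((((0 : ℤ) : ℚ)) ^ 2 - 4 * ((-((n : ℤ) ^ 2) : ℤ) : ℚ)) / 16, 0⟩ :
          WeierstrassCurve ℚ) =
      (congruentNumberCurve n).twoIsogenyCodomain := by
  ext
  · simp [WeierstrassCurve.variableChange_a₁, twoIsogenyCodomain]
  · simp [WeierstrassCurve.variableChange_a₂, twoIsogenyCodomain, congruentNumberCurve]
  · simp [WeierstrassCurve.variableChange_a₃, twoIsogenyCodomain]
  · rw [WeierstrassCurve.variableChange_a₄]
    simp [twoIsogenyCodomain, congruentNumberCurve]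
    ring
  · simp [WeierstrassCurve.variableChange_a₆, twoIsogenyCodomain]

/-- Transport of `#Ш[2^∞]` along an equality of curves. [folklore] -/
theorem natCard_primaryComponent_sha_congr {X Y : WeierstrassCurve ℚ} (h : X = Y) :
    Nat.card (AddCommGroup.primaryComponent X.sha 2) = Nat.card (AddCommGroup.primaryComponent Y.sha 2) := by
  subst h; rfl

/-- Transport of the Mordell–Weil rank along an equality of curves (instances are propositions). [folklore] -/
theorem mordellWeilRank_congr {X Y : WeierstrassCurve ℚ} [X.IsElliptic] [Y.IsElliptic] (h : X = Y) :
    X.mordellWeilRank = Y.mordellWeilRank := by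
  subst h; rfl

/-- Transport of `#α(E(ℚ))` along an equality of curves. [folklore] -/
theorem natCard_range_xSqClass_congr {X Y : WeierstrassCurve ℚ} [X.IsTwoTorsionNF] [Y.IsTwoTorsionNF]
    (h : X = Y) : Nat.card (Set.range X.xSqClass) = Nat.card (Set.range Y.xSqClass) := by
  subst h; rfl

/-- **Cassels' relation for `E_n` and its `2`-isogenous partner `A_n`, `2`-primary form** (granted the functorial
Cassels–Tate pairing over `ℚ` and `Ш(E_n/ℚ)` finite):

  `#Ш(E_n)[2^∞] · 2^{dim S(0,−n²)} · 2^{rank E_n(ℚ) + 2} = #Ш(A_n)[2^∞] · 2^{dim S'(0,−n²)} · #α(E_n(ℚ))²`,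

`S(0,−n²) = Sel^{(φ̂)}` (classes `d ∣ n`), `S'(0,−n²) = Sel^{(φ)}` (classes `d ∣ 2n`), `α` the `x`-coordinate class on `E_n(ℚ)`
(kernel `φ̂(A_n(ℚ))`, Silverman–Tate §3.5). [cite: MilneADT2006, Ch. I, proof of Thm. 7.3 (p. 98), Rem. 6.10(a), Thm. 6.13(a)]
[cite: SilvermanAEC2009, Thm. X.4.2(a), Prop. X.4.9] [cite: SilvermanTate2015, §3.6] -/
theorem card_shaTwo_congruent_mul_eq_of_casselsTate {n : ℕ} (hn : n ≠ 0)
    (hCT : exists_casselsTate_pairing_adjoint ℚ)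
    (hfin : haveI := isElliptic_congruentNumberCurve hn; Finite (congruentNumberCurve n).sha) :
    haveI := isElliptic_congruentNumberCurve hn
    Nat.card (AddCommGroup.primaryComponent (congruentNumberCurve n).sha 2) *
        2 ^ twoIsogenySelmerRank 0 (-((n : ℤ) ^ 2)) * 2 ^ ((congruentNumberCurve n).mordellWeilRank + 2) =
      Nat.card (AddCommGroup.primaryComponent (congruentNumberCurve n).twoIsogenyCodomain.sha 2) *
        2 ^ twoIsogenySelmerRank' 0 (-((n : ℤ) ^ 2)) *
        Nat.card (Set.range (congruentNumberCurve n).xSqClass) ^ 2 := by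
  haveI := isElliptic_congruentNumberCurve hn
  have hab := hab_congruent hn
  haveI hE := isElliptic_mk_of_ne_zero (F := ℚ) hab
  have hlit := congruentNumberCurve_eq_mk n
  have hfin' : Finite (⟨0, ((0 : ℤ) : ℚ), 0, ((-((n : ℤ) ^ 2) : ℤ) : ℚ), 0⟩ : WeierstrassCurve ℚ).sha :=
    finite_sha_congr hlit.symm hfin
  have h := card_shaTwo_mul_two_pow_eq_of_casselsTate hab hCT hfin'
  have hV : Nat.card (AddCommGroup.primaryComponent
      (⟨0, -(((0 : ℤ) : ℚ)) / 2, 0, ((((0 : ℤ) : ℚ)) ^ 2 - 4 * ((-((n : ℤ) ^ 2) : ℤ) : ℚ)) / 16, 0⟩ :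
        WeierstrassCurve ℚ).sha 2) =
      Nat.card (AddCommGroup.primaryComponent (congruentNumberCurve n).twoIsogenyCodomain.sha 2) := by
    rw [← smul_halfModel_eq_twoIsogenyCodomain n, card_primaryComponent_sha_variableChange]
  rw [← natCard_primaryComponent_sha_congr hlit, ← mordellWeilRank_congr hlit, ← natCard_range_xSqClass_congr hlit,
    hV] at h
  exact h


end Summit.BirchSwinnertonDyer.PrintCf2.PartnerSha

end
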